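import Mathlib
import HarnessLib

/-!
# Orthonormal polynomials of a finite measure on a compact interval with infinite support

Helper for the line `FilterInvariance` of the crux `EmbeddedDrudeMourre.GreenKuboContinuation`
(stub S5 `stub_orthonormalPolySeq_exists`): a finite measure `τ` on `ℝ` carried by `[-W, W]`
and charging the complement of every finite set admits an orthonormal polynomial sequence `p n`
with `natDegree (p n) = n` and positive leading coefficients.

Proof: the bilinear form `⟨f, g⟩ = ∫ f g dτ` is an inner product on `ℝ[X]` (every polynomial is
bounded on `[-W, W]`, hence `τ`-integrable; definiteness: a non-zero polynomial has finitely many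
roots, so it is not `τ`-a.e. zero). Mathlib's Gram–Schmidt process applied to the monomials
`X ^ n` in this inner product space gives the sequence; unitriangularity of Gram–Schmidt
(`X ^ n - gramSchmidt n ∈ span {X ^ i | i < n} = degreeLT n`) gives the degrees and the
(positive) leading coefficients `‖gramSchmidt n‖⁻¹`.
-/

noncomputable section

namespace Summit.AtomisticToContinuum.FouriersLaw.Theorems.GreenKuboContinuation.BandLimitedKrylov

open Filter Topology MeasureTheory Set
open Polynomial InnerProductSpace

/-! ### Gram–Schmidt is unitriangular (generic) -/

/-- Gram–Schmidt is unitriangular with respect to its input: `f n - gramSchmidt f n` lies in the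
span of the earlier inputs `f i`, `i < n`. -/
theorem sub_gramSchmidt_mem_span {E : Type*} [NormedAddCommGroup E] [InnerProductSpace ℝ E]
    (f : ℕ → E) (n : ℕ) : f n - gramSchmidt ℝ f n ∈ Submodule.span ℝ (f '' Set.Iio n) := by
  rw [← span_gramSchmidt_Iio ℝ f n, sub_eq_iff_eq_add'.2 (gramSchmidt_def'' ℝ f n)]
  exact Submodule.sum_mem _ fun i hi => Submodule.smul_mem _ _ (Submodule.subset_span
    (Set.mem_image_of_mem (gramSchmidt ℝ f) (Set.mem_Iio.2 (Finset.mem_Iio.1 hi))))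

/-! ### Polynomials in `L²(τ)` -/

section Measure

variable {τ : Measure ℝ} {W : ℝ}

/-- `τ`-almost every point lies in `[-W, W]`. -/
theorem ae_mem_Icc (hW : τ (Set.Icc (-W) W)ᶜ = 0) : ∀ᵐ ω ∂τ, ω ∈ Set.Icc (-W) W := by
  filter_upwards [mem_ae_iff.2 hW] with ω hω using hω

/-- Every polynomial is `τ`-integrable: it is bounded on `[-W, W]`, which carries the finite
measure `τ`. -/
theorem integrable_eval [IsFiniteMeasure τ] (hW : τ (Set.Icc (-W) W)ᶜ = 0) (f : ℝ[X]) :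
    Integrable (fun ω => f.eval ω) τ := by
  obtain ⟨B, hB⟩ := isCompact_Icc.exists_bound_of_continuousOn
    (f.continuous.continuousOn (s := Set.Icc (-W) W))
  exact Integrable.of_bound f.continuous.aestronglyMeasurable B
    ((ae_mem_Icc hW).mono fun ω hω => hB ω hω)

/-- Products of polynomial functions are `τ`-integrable. -/
theorem integrable_eval_mul [IsFiniteMeasure τ] (hW : τ (Set.Icc (-W) W)ᶜ = 0) (f g : ℝ[X]) :
    Integrable (fun ω => f.eval ω * g.eval ω) τ := by
  simpa only [eval_mul] using integrable_eval hW (f * g)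

/-- Definiteness: if `τ` charges the complement of every finite set, a polynomial `f` with
`∫ f² dτ = 0` is the zero polynomial (otherwise `τ` would be carried by the finite root set). -/
theorem eq_zero_of_integral_mul_self_eq_zero [IsFiniteMeasure τ] (hW : τ (Set.Icc (-W) W)ᶜ = 0)
    (hinf : ∀ s : Finset ℝ, τ (↑s : Set ℝ)ᶜ ≠ 0) {f : ℝ[X]}
    (hf : ∫ ω, f.eval ω * f.eval ω ∂τ = 0) : f = 0 := by
  by_contra hf0
  have hae : (fun ω => f.eval ω * f.eval ω) =ᵐ[τ] 0 :=
    (integral_eq_zero_iff_of_nonneg (fun ω => mul_self_nonneg _)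
      (integrable_eval_mul hW f f)).1 hf
  refine hinf f.roots.toFinset (measure_mono_null (fun ω hω => ?_) (ae_iff.1 hae))
  have hω' : f.eval ω ≠ 0 := by
    simpa [Multiset.mem_toFinset, mem_roots hf0] using hω
  simp only [Set.mem_setOf_eq, Pi.zero_apply, mul_self_eq_zero]
  exact hω'

end Measure

/-! ### The stub -/

/-- **S5 `stub_orthonormalPolySeq_exists`.** A finite measure on `ℝ` carried by a compact interval
`[-W, W]` (so that polynomials are square integrable) and with infinite support (so that no non-zero
polynomial vanishes `τ`-a.e., i.e. the moment Gram matrix is positive definite) admits an orthonormal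
polynomial sequence `p_n` with `deg p_n = n` and positive leading coefficients (Gram–Schmidt on
`1, ω, ω², …` in `L²(τ)`). [folklore] -/
theorem stub_orthonormalPolySeq_exists :
    ∀ (τ : Measure ℝ) (W : ℝ), IsFiniteMeasure τ → τ (Set.Icc (-W) W)ᶜ = 0 →
      (∀ s : Finset ℝ, τ (↑s : Set ℝ)ᶜ ≠ 0) →
      ∃ p : ℕ → Polynomial ℝ, (∀ n, (p n).natDegree = n) ∧ (∀ n, 0 < (p n).leadingCoeff) ∧
        ∀ m n, ∫ ω, (p m).eval ω * (p n).eval ω ∂τ = if m = n then 1 else 0 := by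
  intro τ W hfin hW hinf
  -- `ℝ[X]` with the `L²(τ)` inner product `⟨f, g⟩ = ∫ f g dτ` (positive definite because `τ`
  -- charges the complement of every finite set) is an inner product space
  letI core : InnerProductSpace.Core ℝ ℝ[X] :=
    { inner := fun f g => ∫ ω, f.eval ω * g.eval ω ∂τ
      conj_inner_symm := fun f g => by
        simp only [conj_trivial]
        exact integral_congr_ae (Eventually.of_forall fun ω => mul_comm _ _)
      re_inner_nonneg := fun f => by
        simp only [RCLike.re_to_real]
        exact integral_nonneg fun ω => mul_self_nonneg _
      add_left := fun f f' g => by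
        simp only [eval_add, add_mul]
        exact integral_add (integrable_eval_mul hW f g) (integrable_eval_mul hW f' g)
      smul_left := fun f g r => by
        simp only [eval_smul, smul_eq_mul, mul_assoc, conj_trivial]
        exact integral_const_mul r _
      definite := fun f hf => eq_zero_of_integral_mul_self_eq_zero hW hinf hf }
  letI : NormedAddCommGroup ℝ[X] := @InnerProductSpace.Core.toNormedAddCommGroup ℝ ℝ[X] _ _ _ core
  letI : InnerProductSpace ℝ ℝ[X] := InnerProductSpace.ofCore _
  -- the monomials are linearly independent, so Gram–Schmidt does not degenerate
  have hli : LinearIndependent ℝ (fun n : ℕ => (X : ℝ[X]) ^ n) := by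
    have h := (basisMonomials ℝ).linearIndependent
    simp only [coe_basisMonomials, monomial_one_right_eq_X_pow] at h
    exact h
  -- unitriangularity: `gramSchmidt n = X ^ n - (terms of degree < n)`
  have hGS : ∀ n, (gramSchmidt ℝ (fun k : ℕ => (X : ℝ[X]) ^ k) n).natDegree = n ∧
      (gramSchmidt ℝ (fun k : ℕ => (X : ℝ[X]) ^ k) n).Monic := fun n => by
    have hlt : ((X : ℝ[X]) ^ n - gramSchmidt ℝ (fun k : ℕ => (X : ℝ[X]) ^ k) n).degree < n := by
      refine mem_degreeLT.1 ?_
      rw [degreeLT_eq_span_X_pow, Finset.coe_image, Finset.coe_range]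
      exact sub_gramSchmidt_mem_span (fun k : ℕ => (X : ℝ[X]) ^ k) n
    refine ⟨?_, by simpa only [sub_sub_cancel] using monic_X_pow_sub hlt⟩
    have hlt' : ((X : ℝ[X]) ^ n - gramSchmidt ℝ (fun k : ℕ => (X : ℝ[X]) ^ k) n).degree <
        ((X : ℝ[X]) ^ n).degree := by
      rwa [degree_X_pow]
    have h := degree_sub_eq_left_of_degree_lt hlt'
    rw [sub_sub_cancel, degree_X_pow] at h
    exact natDegree_eq_of_degree_eq_some h
  -- normalisation multiplies by the positive constant `‖gramSchmidt n‖⁻¹`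
  have hpos : ∀ n, 0 < ‖gramSchmidt ℝ (fun k : ℕ => (X : ℝ[X]) ^ k) n‖⁻¹ := fun n =>
    inv_pos.2 (norm_pos_iff.2 (gramSchmidt_ne_zero n hli))
  have hGSN : ∀ n, gramSchmidtNormed ℝ (fun k : ℕ => (X : ℝ[X]) ^ k) n =
      C ‖gramSchmidt ℝ (fun k : ℕ => (X : ℝ[X]) ^ k) n‖⁻¹ *
        gramSchmidt ℝ (fun k : ℕ => (X : ℝ[X]) ^ k) n := fun n => by
    rw [gramSchmidtNormed, ← smul_eq_C_mul]
    rfl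
  refine ⟨gramSchmidtNormed ℝ fun k : ℕ => (X : ℝ[X]) ^ k, fun n => ?_, fun n => ?_,
    fun m n => ?_⟩
  · rw [hGSN, natDegree_C_mul (hpos n).ne']
    exact (hGS n).1
  · rw [hGSN, leadingCoeff_mul, leadingCoeff_C, (hGS n).2.leadingCoeff, mul_one]
    exact hpos n
  · exact orthonormal_iff_ite.1 (gramSchmidtNormed_orthonormal hli) m n

end Summit.AtomisticToContinuum.FouriersLaw.Theorems.GreenKuboContinuation.BandLimitedKrylov

end
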